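import Summits.KontsevichZagierPeriods.KontsevichZagierPeriods.Theses.HurwitzMicroSectors

/-!
# Strategist gen 2 — crux `NormalFormPrinciple` (stmt-KontsevichZagierPeriods-3869)
# First-lemma signatures for the crux idea `m3-equal-value-instances` (lens: negation, by-products of N9)

Six transcendence-FREE instances of the leaf `stub_boxRigidity` in dimension three: pairs of
box-rational representations on `(0,1)³` (one pair drops to `(0,1)²`) whose values AGREE (jobs j022722 /
j022735, 480-digit agreement; each is an identity among (alternating) Euler sums / polylogarithms at
`1/2` of weight ≤ 3), so Conjecture 1 predicts a chain of moves and no independence input is involved.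
None is generated by integrand identities, the dilations `(x,y,z) ↦ (xᵏ,yᵏ,zᵏ)`, the 48 box
symmetries or polynomial Newton–Leibniz alone (N9's predicted lattice); each needs a genuine
dissection / simplex chart / duality step. Pure move-finding targets (M/L) for the `m = 3` layer.
-/

namespace Summit.KontsevichZagierPeriods.KontsevichZagierPeriods.Theses.HurwitzMicroSectors.StrategistGen2

open Literature.NumberTheory.Transcendental

/-- The open unit box in dimension `n`. -/
def box (n : ℕ) : Set (Fin n → ℝ) := {x | ∀ i, x i ∈ Set.Ioo (0:ℝ) 1}

/-- **EulerBoxDuality** (`ζ(2,1) + ζ(3) = 2ζ(3)`, i.e. Euler's `ζ(2,1) = ζ(3)` in box form):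
`[(0,1)³, 1/((1−xy)(1−xyz))] ∼ [(0,1)³, 2/(1−xyz)]`. Route: simplex chart `(t₁,t₂,t₃) = (x, xy, xyz)`
(rule 2, Jacobian `x²y`), integrand additivity into the words `ω₀ω₀ω₁ + ω₀ω₁ω₁`, DUALITY (one affine
move, `FurushoPentagon.DualityInKZ.of_sub_of_mem_relations_of_dualWord`), chart back. -/
def EulerBoxDuality : Prop :=
  ∀ (r r' : KZ.IntegralRep 3), r.domain = box 3 →
    Set.EqOn r.integrand (fun x => 1 / ((1 - x 0 * x 1) * (1 - x 0 * x 1 * x 2))) (box 3) →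
    r'.domain = box 3 → Set.EqOn r'.integrand (fun x => 2 / (1 - x 0 * x 1 * x 2)) (box 3) →
    KZ.Equivalent r r'

/-- **FiveEighthsZetaThree** (alternating Euler sums, level 2): `8·∫dV/((1+xy)(1+xyz)) = 5·ζ(3)`:
`[(0,1)³, 8/((1+xy)(1+xyz))] ∼ [(0,1)³, 5/(1−xyz)]`. -/
def FiveEighthsZetaThree : Prop :=
  ∀ (r r' : KZ.IntegralRep 3), r.domain = box 3 →
    Set.EqOn r.integrand (fun x => 8 / ((1 + x 0 * x 1) * (1 + x 0 * x 1 * x 2))) (box 3) →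
    r'.domain = box 3 → Set.EqOn r'.integrand (fun x => 5 / (1 - x 0 * x 1 * x 2)) (box 3) →
    KZ.Equivalent r r'

/-- **HalfPointZetaThree** (polylogarithms at `1/2`, all `log 2` terms cancel):
`16·∫dV/((2−x)(2−xyz)) = 5·ζ(3)`: `[(0,1)³, 16/((2−x)(2−xyz))] ∼ [(0,1)³, 5/(1−xyz)]`. -/
def HalfPointZetaThree : Prop :=
  ∀ (r r' : KZ.IntegralRep 3), r.domain = box 3 →
    Set.EqOn r.integrand (fun x => 16 / ((2 - x 0) * (2 - x 0 * x 1 * x 2))) (box 3) →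
    r'.domain = box 3 → Set.EqOn r'.integrand (fun x => 5 / (1 - x 0 * x 1 * x 2)) (box 3) →
    KZ.Equivalent r r'

/-- **HalfPointDuality**: `2·∫dV/((2−xy)(2−xyz)) = ∫dV/((1+x)(1+xyz))` (both `= 0.6319661978…`):
`[(0,1)³, 2/((2−xy)(2−xyz))] ∼ [(0,1)³, 1/((1+x)(1+xyz))]`. -/
def HalfPointDuality : Prop :=
  ∀ (r r' : KZ.IntegralRep 3), r.domain = box 3 →
    Set.EqOn r.integrand (fun x => 2 / ((2 - x 0 * x 1) * (2 - x 0 * x 1 * x 2))) (box 3) →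
    r'.domain = box 3 → Set.EqOn r'.integrand (fun x => 1 / ((1 + x 0) * (1 + x 0 * x 1 * x 2))) (box 3) →
    KZ.Equivalent r r'

/-- **WeightDropTornheim** (`Σ_{m,n≥1} 1/(mn(m+n−1)) = 2ζ(2)`; a DIMENSION-CHANGING transcendence-free
pair): `[(0,1)³, 1/((1−xy)(1−xz))] ∼ [(0,1)², 2/(1−xy)]`. -/
def WeightDropTornheim : Prop :=
  ∀ (r : KZ.IntegralRep 3) (r' : KZ.IntegralRep 2), r.domain = box 3 →
    Set.EqOn r.integrand (fun x => 1 / ((1 - x 0 * x 1) * (1 - x 0 * x 2))) (box 3) →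
    r'.domain = box 2 → Set.EqOn r'.integrand (fun x => 2 / (1 - x 0 * x 1)) (box 2) →
    KZ.Equivalent r r'

/-- **HalfPointZetaTwoLogTwo** (weight-3 product value `ζ(2)·log 2` reached from the `1/2`-world):
`4·∫dV/((2−x)(1−xyz)) = 3·∫dV/((1−xy)(1+z))` (`= 3ζ(2) log 2`):
`[(0,1)³, 4/((2−x)(1−xyz))] ∼ [(0,1)³, 3/((1−xy)(1+z))]`. -/
def HalfPointZetaTwoLogTwo : Prop :=
  ∀ (r r' : KZ.IntegralRep 3), r.domain = box 3 →
    Set.EqOn r.integrand (fun x => 4 / ((2 - x 0) * (1 - x 0 * x 1 * x 2))) (box 3) →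
    r'.domain = box 3 → Set.EqOn r'.integrand (fun x => 3 / ((1 - x 0 * x 1) * (1 + x 2))) (box 3) →
    KZ.Equivalent r r'

end Summit.KontsevichZagierPeriods.KontsevichZagierPeriods.Theses.HurwitzMicroSectors.StrategistGen2
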